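import Summits.QuantumFields.GaugeBoot.Rows.GLYZc2D3HCanon1
import Summits.QuantumFields.GaugeBoot.Rows.GLYZc2D3HCanon2
import Summits.QuantumFields.GaugeBoot.Rows.GLYZc2D3HCanon3
import Summits.QuantumFields.GaugeBoot.Rows.GLYZc2D3LCanon1
import Summits.QuantumFields.GaugeBoot.Rows.GLYZc2D3SCanon1
import HarnessLib

/-!
# Gauge-boot: every RAW block entry of the glyz-c2-rp-3D problems is a labelled variable in expectation

Cell `pub-gaugeboot` (HOME `run/shared/lean/pub/pub-gaugeboot/`), seat lean1 (binding layer for rows C32–C33, C51–C60 = the certified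
glyz-c2-rp-3D windows: label sets, class/witness tables, the reduction identity, soundness, per-β bindings).

HONEST FRAMING (page 1 of every file of this cell): certified bounds on lattice expectations at STATED coupling,
gauge group, dimension and torus size; NOT a mass gap, NOT a continuum limit, NOT a string tension, NOT large `N`.
The venture is explicitly NOT Yang–Mills-summit-bearing (barriers `FixedCouplingUltralocality`,
`PerturbativeInvisibility`).

Assembles the kernel-checked class tables (`hcanon`, `scanon`, `lcanon` for the stored half `a ≤ b`; the other half by the
symmetry lemmas of `GLYZc2D3Blocks`) into `H_entry` / `site_entry` / `link_entry`: on every torus and at every real `β`,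
`⟨W_0(rawH a b)⟩ = y (hcls a b)` etc. (`y v = ⟨W_0(label v)⟩`), and restates the three raw PSD theorems in the problem
VARIABLES (`H_nonneg_label`, `site_nonneg_label`, `link_nonneg_label`) and as `Matrix.PosSemidef` of the class-table matrices
(`rawBlockH/S/L_posSemidef`) — the input of the reduction step `GLYZc2D3Red` (reduced block `k` = `Y_kᵀ·raw·Y_k`).
-/

noncomputable section

open Literature.MathematicalPhysics.QuantumFieldTheory
open Matrix

namespace Summit.QuantumFields.GaugeBoot

namespace GLYZc2D3

/-- **Every stored entry (`i ≤ j`) of the `H` table canonicalises** (assembly of the range checks). -/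
theorem hcanon (i j : Fin 181) (hij : i.val ≤ j.val) : HCanonOK i j := by
  have h0 : 0 ≤ i.val := Nat.zero_le _
  rcases Nat.lt_or_ge i.val 7 with h1 | h1
  · exact hcanon_rows_0_7 i h0 h1 j hij
  rcases Nat.lt_or_ge i.val 14 with h2 | h2
  · exact hcanon_rows_7_14 i h1 h2 j hij
  rcases Nat.lt_or_ge i.val 22 with h3 | h3
  · exact hcanon_rows_14_22 i h2 h3 j hij
  rcases Nat.lt_or_ge i.val 30 with h4 | h4
  · exact hcanon_rows_22_30 i h3 h4 j hij
  rcases Nat.lt_or_ge i.val 38 with h5 | h5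
  · exact hcanon_rows_30_38 i h4 h5 j hij
  rcases Nat.lt_or_ge i.val 47 with h6 | h6
  · exact hcanon_rows_38_47 i h5 h6 j hij
  rcases Nat.lt_or_ge i.val 56 with h7 | h7
  · exact hcanon_rows_47_56 i h6 h7 j hij
  rcases Nat.lt_or_ge i.val 66 with h8 | h8
  · exact hcanon_rows_56_66 i h7 h8 j hij
  rcases Nat.lt_or_ge i.val 77 with h9 | h9
  · exact hcanon_rows_66_77 i h8 h9 j hij
  rcases Nat.lt_or_ge i.val 89 with h10 | h10
  · exact hcanon_rows_77_89 i h9 h10 j hij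
  rcases Nat.lt_or_ge i.val 103 with h11 | h11
  · exact hcanon_rows_89_103 i h10 h11 j hij
  rcases Nat.lt_or_ge i.val 120 with h12 | h12
  · exact hcanon_rows_103_120 i h11 h12 j hij
  rcases Nat.lt_or_ge i.val 143 with h13 | h13
  · exact hcanon_rows_120_143 i h12 h13 j hij
  exact hcanon_rows_143_181 i h13 i.isLt j hij

/-- **Every stored entry (`i ≤ j`) of the `S` table canonicalises** (assembly of the range checks). -/
theorem scanon (i j : Fin 94) (hij : i.val ≤ j.val) : SCanonOK i j := by
  have h0 : 0 ≤ i.val := Nat.zero_le _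
  rcases Nat.lt_or_ge i.val 14 with h1 | h1
  · exact scanon_rows_0_14 i h0 h1 j hij
  rcases Nat.lt_or_ge i.val 30 with h2 | h2
  · exact scanon_rows_14_30 i h1 h2 j hij
  rcases Nat.lt_or_ge i.val 52 with h3 | h3
  · exact scanon_rows_30_52 i h2 h3 j hij
  exact scanon_rows_52_94 i h3 i.isLt j hij

/-- **Every stored entry (`i ≤ j`) of the `L` table canonicalises** (assembly of the range checks). -/
theorem lcanon (i j : Fin 94) (hij : i.val ≤ j.val) : LCanonOK i j := by
  have h0 : 0 ≤ i.val := Nat.zero_le _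
  rcases Nat.lt_or_ge i.val 14 with h1 | h1
  · exact lcanon_rows_0_14 i h0 h1 j hij
  rcases Nat.lt_or_ge i.val 30 with h2 | h2
  · exact lcanon_rows_14_30 i h1 h2 j hij
  rcases Nat.lt_or_ge i.val 52 with h3 | h3
  · exact lcanon_rows_30_52 i h2 h3 j hij
  exact lcanon_rows_52_94 i h3 i.isLt j hij

variable (β : ℝ) (L : ℕ) [NeZero L]

/-- **`H` entries are problem variables**: `⟨W_0(rawH a b)⟩ = y (hcls a b)` (every torus, every real `β`). -/
theorem H_entry (a b : Fin 181) : Rung0D3.W β L (rawH a b) = y β L (hcls a b) := by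
  rcases Nat.lt_or_ge b.val a.val with hab | hab
  · rw [W_rawH_symm β L b a, hcls_comm, y, ← hcanon b a hab.le, W_canonW β L _ _ (disp_rawH b a)]
  · rw [y, ← hcanon a b hab, W_canonW β L _ _ (disp_rawH a b)]

/-- **`site1` entries are problem variables**: `⟨W_0(rawS a b)⟩ = y (scls a b)` (every torus, every real `β`). -/
theorem site_entry (a b : Fin 94) : Rung0D3.W β L (rawS a b) = y β L (scls a b) := by
  rcases Nat.lt_or_ge b.val a.val with hab | hab
  · rw [W_rawS_symm β L b a, scls_comm, y, ← scanon b a hab.le, W_canonW β L _ _ (disp_rawS b a)]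
  · rw [y, ← scanon a b hab, W_canonW β L _ _ (disp_rawS a b)]

/-- **`link1` entries are problem variables**: `⟨W_0(rawL a b)⟩ = y (lcls a b)` (every torus, every real `β`). -/
theorem link_entry (a b : Fin 94) : Rung0D3.W β L (rawL a b) = y β L (lcls a b) := by
  rcases Nat.lt_or_ge b.val a.val with hab | hab
  · rw [W_rawL_symm β L b a, lcls_comm, y, ← lcanon b a hab.le, W_canonW β L _ _ (disp_rawL b a)]
  · rw [y, ← lcanon a b hab, W_canonW β L _ _ (disp_rawL a b)]

/-- **The raw `H` block in the problem variables is PSD** (every torus, every real `β`). -/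
theorem H_nonneg_label (c : Fin 181 → ℝ) : 0 ≤ ∑ a, ∑ b, c a * c b * y β L (hcls a b) := by
  have h := H_nonneg β L c
  simp only [H_entry] at h
  exact h

/-- **The raw `site1` block in the problem variables is PSD** (every even torus, every real `β`). -/
theorem site_nonneg_label (hL : Even L) (c : Fin 94 → ℝ) : 0 ≤ ∑ a, ∑ b, c a * c b * y β L (scls a b) := by
  have h := site_nonneg β L hL c
  simp only [site_entry] at h
  exact h

/-- **The raw `link1` block in the problem variables is PSD** (every even torus `L ≥ 4`, every `β ≥ 0`). -/
theorem link_nonneg_label (hL : Even L) (h4 : 4 ≤ L) (hβ : 0 ≤ β) (c : Fin 94 → ℝ) :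
    0 ≤ ∑ a, ∑ b, c a * c b * y β L (lcls a b) := by
  have h := link_nonneg β L hL h4 hβ c
  simp only [link_entry] at h
  exact h

/-- A real matrix whose entries are a symmetric relabelling of a PSD quadratic form is positive semidefinite. -/
theorem posSemidef_of_table {n : ℕ} (cls : ℕ → ℕ → Fin 1449) (hsymm : ∀ i j, cls i j = cls j i)
    (hq : ∀ c : Fin n → ℝ, 0 ≤ ∑ i : Fin n, ∑ j : Fin n, c i * c j * y β L (cls i j)) :
    (Matrix.of fun i j : Fin n => y β L (cls i j)).PosSemidef := by
  refine Matrix.PosSemidef.of_dotProduct_mulVec_nonneg ?_ fun x => ?_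
  · ext i j
    simp only [Matrix.conjTranspose_apply, Matrix.of_apply, star_trivial, hsymm i j]
  · have h := hq x
    simp only [dotProduct, Matrix.mulVec, Matrix.of_apply, star_trivial, Finset.mul_sum] at h ⊢
    exact h.trans_eq (Finset.sum_congr rfl fun i _ => Finset.sum_congr rfl fun j _ => by ring)

/-- The raw `H` block as a matrix of variables. -/
def rawBlockH : Matrix (Fin 181) (Fin 181) ℝ := Matrix.of fun a b => y β L (hcls a b)

/-- The raw `site1` block as a matrix of variables. -/
def rawBlockS : Matrix (Fin 94) (Fin 94) ℝ := Matrix.of fun a b => y β L (scls a b)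

/-- The raw `link1` block as a matrix of variables. -/
def rawBlockL : Matrix (Fin 94) (Fin 94) ℝ := Matrix.of fun a b => y β L (lcls a b)

/-- **The raw `H` block (in the variables, on the torus state) is positive semidefinite.** -/
theorem rawBlockH_posSemidef : (rawBlockH β L).PosSemidef :=
  posSemidef_of_table β L _ hcls_comm (H_nonneg_label β L)

/-- **The raw `site1` block is positive semidefinite** (even `L`). -/
theorem rawBlockS_posSemidef (hL : Even L) : (rawBlockS β L).PosSemidef :=
  posSemidef_of_table β L _ scls_comm (site_nonneg_label β L hL)

/-- **The raw `link1` block is positive semidefinite** (even `L ≥ 4`, `β ≥ 0`). -/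
theorem rawBlockL_posSemidef (hL : Even L) (h4 : 4 ≤ L) (hβ : 0 ≤ β) : (rawBlockL β L).PosSemidef :=
  posSemidef_of_table β L _ lcls_comm (link_nonneg_label β L hL h4 hβ)

end GLYZc2D3

end Summit.QuantumFields.GaugeBoot

end
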